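import Summits.BirchSwinnertonDyer.Rank1Residual.F1Sign2.MinusHalfSumAwayProofs
import HarnessLib

/-!
# Cell `bsd-f1-sign2`, AN-33 PROOFS AWAY FROM `M` (§6♯–§7♯): the closed form of `F_m mod 2u` and the units-only half-sum law for symbol units away from `M` — KERNEL-CHECKED (-an g16, Sketch_v37 §6–§7)

PORT (cell `bsd-f1-sign2`, seat `-ty` g11) of -an g16's tree-rebased file of record `MEMO-an-data/g16/Sketch_v37.lean` 454eaaa5b944aeb6 (= MEMO-an v1.40 /
`Sketch_v36.lean` 335ae8cb61bfaf5b rebased on the tree: imports `F1Sign2/UnitDoorParityAtTwo` + `F1Sign2/TwistedMinusSymbolSumProofs`, the 37 decls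
byte-identical in the tree deleted, the v32-generalised «units AWAY from M» helpers renamed `…_away`; farm rc 0 · 0 err · 0 warn · 0 sorry,
`bc/Sketch_v37_check.json` 6d9656a1424da834; evidence #60 on stmt-23715).  REF1 §126 (refuter-bsd-f1-sign2-ref1 g11, 2026-08-28T17:18:39Z): «§4–§10 Away
generalisation clean; 29/29 new theorems axioms {propext, Classical.choice, Quot.sound}».  Typer edits = this header, the section ranges, added
docstrings on undocumented helpers; proofs VERBATIM.  Nothing here proves BSD; 23715 not closed.
Sections §6–§7 of the port file: `minusHalfSum_closedForm_modTwo_away`, `exists_int_minusHalfSumUnits_eq_mul_away`,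
`minusHalfSumUnits_closedForm_modTwo_away` (AN-33j away from `M`) with helpers; imports §5♯ (`MinusHalfSumAwayProofs`); the tree's §6/§7 special
versions (p648145, p648400) stay.  [cite: Zhai2016, Lemmas 2.2–2.3] [cite: CaiLiZhai2019, Lemma 4.1]
-/

set_option autoImplicit false

noncomputable section

open scoped Classical MatrixGroups ModularForm

open CongruenceSubgroup WeierstrassCurve Literature.NumberTheory.EllipticCurves Literature.NumberTheory.EllipticCurves.ModularForms

namespace Summit.BirchSwinnertonDyer.Rank1Residual.F1Sign2.ANg16

/-! ### §6 PROOFS (v27): the closed form of `F_m mod 2u` over square-free odd levels (AN-33b iterated along the prime factorisation + AN-33c). -/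

section ClosedForm

variable {N : ℕ} [NeZero N] (f : CuspForm (Gamma0 N) 2)

/-- **Closed form of the minus half-sums mod `2u` (symbol half of AN-33f, PROVED).**  Let `f` be a newform with rational
coefficients, `u` a symbol unit, and `q₀ ∤ N` an odd prime with `a_{q₀}` odd (a "`3`-cycle prime").  For every square-free odd `m`
all of whose prime factors `q` satisfy `q ∤ N` (with `a_q(f) = a q`):
`F_m ≡ F_{q₀} (mod 2u)` if some prime factor of `m` has `a_q` odd, and `F_m ≡ 0 (mod 2u)` if all have `a_q` even. -/
theorem minusHalfSum_closedForm_modTwo_away (hf : IsNewform0 f) (hQ : coeffField f = ⊥) {M : ℕ} {u : ℚ} (hu : IsMinusSymbolUnitAway f M u)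
    {q₀ : ℕ} (hq₀ : q₀.Prime) (hq₀o : Odd q₀) (hq₀N : ¬ q₀ ∣ N) (hq₀M : q₀.Coprime M) {a₀ : ℤ} (ha₀ : cuspCoeff f q₀ = (a₀ : ℂ))
    (ha₀o : Odd a₀) (a : ℕ → ℤ) (m : ℕ) (hsq : Squarefree m) (hmo : Odd m) (hmM : m.Coprime M)
    (hpr : ∀ q ∈ m.primeFactors, ¬ q ∣ N ∧ cuspCoeff f q = (a q : ℂ)) :
    ((∃ q ∈ m.primeFactors, Odd (a q)) → ∃ z : ℤ, minusHalfSum f m = minusHalfSum f q₀ + 2 * z * u) ∧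
    ((∀ q ∈ m.primeFactors, Even (a q)) → ∃ z : ℤ, minusHalfSum f m = 2 * z * u) := by
  obtain ⟨b₀, hb₀⟩ := ha₀o
  obtain ⟨y, hy⟩ := exists_int_minusHalfSum_eq_mul_away hu q₀ hq₀M
  have hb₀Q : ((a₀ : ℤ) : ℚ) = 2 * (b₀ : ℚ) + 1 := by exact_mod_cast hb₀
  -- the value at a single prime `q ∤ N`: `F_q ≡ F_{q₀}` if `a_q` odd, `F_q ≡ 0` if `a_q` even
  have hprime : ∀ q : ℕ, q.Prime → Odd q → ¬ q ∣ N → q.Coprime M → cuspCoeff f q = (a q : ℂ) →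
      (Odd (a q) → ∃ z : ℤ, minusHalfSum f q = minusHalfSum f q₀ + 2 * z * u) ∧
      (Even (a q) → ∃ z : ℤ, minusHalfSum f q = 2 * z * u) := by
    intro q hq hqo hqN hqM haq
    obtain ⟨xq, hxq⟩ := exists_int_minusHalfSum_eq_mul_away hu q hqM
    by_cases hqq : q = q₀
    · subst hqq
      have haa : a q = a₀ := by
        have : ((a q : ℤ) : ℂ) = (a₀ : ℂ) := by rw [← haq, ha₀]
        exact_mod_cast this
      refine ⟨fun _ => ⟨0, by ring⟩, fun hev => ?_⟩
      exfalso
      obtain ⟨b, hb⟩ := hev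
      omega
    obtain ⟨z₁, hz₁⟩ := minusHalfSumProportionality f hf hQ hu hq hq₀ hqo hq₀o hqq hqN hq₀N hqM hq₀M haq ha₀
    refine ⟨fun hod => ?_, fun hev => ?_⟩
    · obtain ⟨b, hb⟩ := hod
      have hbQ : ((a q : ℤ) : ℚ) = 2 * (b : ℚ) + 1 := by exact_mod_cast hb
      refine ⟨z₁ - b₀ * xq + b * y, ?_⟩
      rw [hbQ, hb₀Q] at hz₁
      rw [hxq, hy] at hz₁ ⊢
      push_cast
      linear_combination hz₁
    · obtain ⟨b, hb⟩ := hev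
      have hbQ : ((a q : ℤ) : ℚ) = (b : ℚ) + b := by exact_mod_cast hb
      refine ⟨z₁ + b * y - b₀ * xq, ?_⟩
      rw [hbQ, hb₀Q] at hz₁
      rw [hxq, hy] at hz₁
      rw [hxq]
      push_cast
      linear_combination hz₁
  -- strong induction on `m`
  induction m using Nat.strong_induction_on with
  | _ m ih =>
    by_cases hm1 : m = 1
    · subst hm1
      refine ⟨fun ⟨q, hq, _⟩ => by simp at hq, fun _ => ⟨0, ?_⟩⟩
      simp [minusHalfSum]
    have hm0 : m ≠ 0 := by rintro rfl; exact absurd hmo (by decide)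
    set q := m.minFac with hq_def
    have hq : q.Prime := Nat.minFac_prime hm1
    have hqm : q ∣ m := Nat.minFac_dvd m
    set m' := m / q with hm'_def
    have hmm' : m = q * m' := (Nat.mul_div_cancel' hqm).symm
    have hm'0 : m' ≠ 0 := by intro h; rw [h, mul_zero] at hmm'; exact hm0 hmm'
    have hqo : Odd q := hmo.of_dvd_nat hqm
    have hm'dvd : m' ∣ m := Nat.div_dvd_of_dvd hqm
    have hm'o : Odd m' := hmo.of_dvd_nat hm'dvd
    have hsq' : Squarefree m' := hsq.squarefree_of_dvd hm'dvd
    have hcop : Nat.Coprime q m' := Nat.coprime_of_squarefree_mul (hmm' ▸ hsq)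
    have hqm' : ¬ q ∣ m' := (Nat.Prime.coprime_iff_not_dvd hq).1 hcop
    have hlt : m' < m := by
      rw [hm'_def]; exact Nat.div_lt_self (Nat.pos_of_ne_zero hm0) hq.one_lt
    have hqmem : q ∈ m.primeFactors := Nat.mem_primeFactors.2 ⟨hq, hqm, hm0⟩
    have hsub : ∀ q' ∈ m'.primeFactors, q' ∈ m.primeFactors := fun q' hq' => Nat.primeFactors_mono hm'dvd hm0 hq'
    have hsplit : ∀ q' ∈ m.primeFactors, q' = q ∨ q' ∈ m'.primeFactors := by
      intro q' hq'
      rw [hmm', Nat.primeFactors_mul hq.ne_zero hm'0, Finset.mem_union, hq.primeFactors, Finset.mem_singleton] at hq'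
      exact hq'
    have hm'M : m'.Coprime M := Nat.Coprime.coprime_dvd_left hm'dvd hmM
    have hqM : q.Coprime M := Nat.Coprime.coprime_dvd_left hqm hmM
    have ih' := ih m' hlt hsq' hm'o hm'M (fun q' hq' => hpr q' (hsub q' hq'))
    obtain ⟨z, hz⟩ := minusHalfSumHeckeStep_away f hf hQ hu hm'M hqM hm'o hq hqo (hpr q hqmem).1 hqm' (hpr q hqmem).2
    rw [← hmm'] at hz
    obtain ⟨x', hx'⟩ := exists_int_minusHalfSum_eq_mul_away hu m' hm'M
    have hPq := hprime q hq hqo (hpr q hqmem).1 hqM (hpr q hqmem).2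
    rcases Int.even_or_odd (a q) with hev | hod
    · -- `a_q` even: `F_m ≡ F_{m'} + F_q ≡ F_{m'}`
      obtain ⟨zq, hzq⟩ := hPq.2 hev
      obtain ⟨b, hb⟩ := hev
      have hbQ : ((a q : ℤ) : ℚ) = (b : ℚ) + b := by exact_mod_cast hb
      rw [hbQ, hzq] at hz
      refine ⟨fun ⟨q', hq', hq'o⟩ => ?_, fun hall => ?_⟩
      · have hq'm' : q' ∈ m'.primeFactors := by
          rcases hsplit q' hq' with h | h
          · exfalso; subst h; rw [hb] at hq'o; exact (Int.not_odd_iff_even.2 ⟨b, rfl⟩) hq'o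
          · exact h
        obtain ⟨z', hz'⟩ := ih'.1 ⟨q', hq'm', hq'o⟩
        refine ⟨z + zq + (b + b - 1) * z' + (b - 1) * y + 0, ?_⟩
        rw [hz', hy] at hz
        rw [hy]
        push_cast
        linear_combination hz
      · obtain ⟨z', hz'⟩ := ih'.2 (fun q' hq' => hall q' (hsub q' hq'))
        refine ⟨z + zq + (b + b - 1) * z', ?_⟩
        rw [hz'] at hz
        push_cast
        linear_combination hz
    · -- `a_q` odd: `F_m ≡ F_q ≡ F_{q₀}`
      obtain ⟨zq, hzq⟩ := hPq.1 hod
      obtain ⟨b, hb⟩ := hod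
      have hbQ : ((a q : ℤ) : ℚ) = 2 * (b : ℚ) + 1 := by exact_mod_cast hb
      rw [hbQ, hzq, hx'] at hz
      refine ⟨fun _ => ⟨z + zq + b * x', ?_⟩, fun hall => ?_⟩
      · push_cast
        linear_combination hz
      · exfalso
        obtain ⟨c, hc⟩ := hall q hqmem
        omega

end ClosedForm

/-! ### §7 PROOFS (v27): the gcd-partition `F_m = Σ_{d ∣ m} F×_d`, the divisor-count parity by involution, and AN-33j. -/

section UnitsSum

open Finset

variable {N : ℕ} (f : CuspForm (Gamma0 N) 2)

/-- -an g16 helper (Sketch_v37, proofs port; kernel-checked). -/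
theorem exists_int_minusHalfSumUnits_eq_mul_away {M : ℕ} {u : ℚ} (hu : IsMinusSymbolUnitAway f M u) (m : ℕ) (hmM : m.Coprime M) :
    ∃ a : ℤ, minusHalfSumUnits f m = a * u :=
  exists_int_sum_ratMinusSymbol_eq_mul_away hu _ _ fun k _ => den_natCast_div_natCast_coprime hmM k

end UnitsSum

section UnitsClosedForm

open Finset

variable {N : ℕ} [NeZero N] (f : CuspForm (Gamma0 N) 2)

/-- **Closed form of the units-only half-sum mod `2u` (the composite-door symbol law, PROVED).**  Same setting as
`minusHalfSum_closedForm_modTwo_away`.  For every square-free odd `m` with all prime factors `q ∤ N`: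
`F×_m ≡ F_{q₀} (mod 2u)` if `m > 1` and EVERY prime factor of `m` has `a_q` odd (a "pure `3`-cycle" level), and
`F×_m ≡ 0 (mod 2u)` otherwise.  (So the mod-2 value of every such twisted Birch–Manin half-sum of `f` is one bit `η_f` times
the indicator of "pure `3`-cycle".) -/
theorem minusHalfSumUnits_closedForm_modTwo_away (hf : IsNewform0 f) (hQ : coeffField f = ⊥) {M : ℕ} {u : ℚ}
    (hu : IsMinusSymbolUnitAway f M u) {q₀ : ℕ} (hq₀ : q₀.Prime) (hq₀o : Odd q₀) (hq₀N : ¬ q₀ ∣ N) (hq₀M : q₀.Coprime M) {a₀ : ℤ}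
    (ha₀ : cuspCoeff f q₀ = (a₀ : ℂ)) (ha₀o : Odd a₀) (a : ℕ → ℤ) (m : ℕ) (hsq : Squarefree m) (hmo : Odd m) (hmM : m.Coprime M)
    (hpr : ∀ q ∈ m.primeFactors, ¬ q ∣ N ∧ cuspCoeff f q = (a q : ℂ)) :
    ((1 < m ∧ ∀ q ∈ m.primeFactors, Odd (a q)) →
        ∃ z : ℤ, minusHalfSumUnits f m = minusHalfSum f q₀ + 2 * z * u) ∧
    (¬ (1 < m ∧ ∀ q ∈ m.primeFactors, Odd (a q)) → ∃ z : ℤ, minusHalfSumUnits f m = 2 * z * u) := by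
  obtain ⟨y, hy⟩ := exists_int_minusHalfSum_eq_mul_away hu q₀ hq₀M
  induction m using Nat.strong_induction_on with
  | _ m ih =>
    by_cases hm1 : m = 1
    · subst hm1
      have h0 : minusHalfSumUnits f 1 = 0 := by simp [minusHalfSumUnits]
      exact ⟨fun ⟨h, _⟩ => absurd h (by decide), fun _ => ⟨0, by rw [h0]; ring⟩⟩
    have hm0 : m ≠ 0 := by rintro rfl; exact absurd hmo (by decide)
    have hm1' : 1 < m := by omega
    -- (i) `F_m = F×_m + Σ_{proper divisors} F×_d`
    have hsum : minusHalfSum f m = minusHalfSumUnits f m + ∑ d ∈ m.properDivisors, minusHalfSumUnits f d := by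
      rw [minusHalfSum_eq_sum_divisors_minusHalfSumUnits f hm0, ← Nat.cons_self_properDivisors hm0, sum_cons]
    -- (ii) termwise closed form on the proper divisors (induction hypothesis)
    have hterm : ∀ d ∈ m.properDivisors, ∃ z : ℤ, minusHalfSumUnits f d -
        (if (1 < d ∧ ∀ q ∈ d.primeFactors, Odd (a q)) then minusHalfSum f q₀ else 0) = 2 * z * u := by
      intro d hd
      rw [Nat.mem_properDivisors] at hd
      obtain ⟨hdm, hdlt⟩ := hd
      have ihd := ih d hdlt (hsq.squarefree_of_dvd hdm) (hmo.of_dvd_nat hdm) (Nat.Coprime.coprime_dvd_left hdm hmM)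
        (fun q hq => hpr q (Nat.primeFactors_mono hdm hm0 hq))
      by_cases hP : (1 < d ∧ ∀ q ∈ d.primeFactors, Odd (a q))
      · obtain ⟨z, hz⟩ := ihd.1 hP
        exact ⟨z, by rw [if_pos hP, hz]; ring⟩
      · obtain ⟨z, hz⟩ := ihd.2 hP
        exact ⟨z, by rw [if_neg hP, hz]; ring⟩
    obtain ⟨Z, hZ⟩ := exists_int_sum_sub_sum m.properDivisors (fun d => minusHalfSumUnits f d)
      (fun d => if (1 < d ∧ ∀ q ∈ d.primeFactors, Odd (a q)) then minusHalfSum f q₀ else 0) hterm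
    have hite : ∑ d ∈ m.properDivisors, (if (1 < d ∧ ∀ q ∈ d.primeFactors, Odd (a q)) then minusHalfSum f q₀ else 0)
        = ((m.properDivisors.filter (fun d => 1 < d ∧ ∀ q ∈ d.primeFactors, Odd (a q))).card : ℚ)
          * minusHalfSum f q₀ := by
      rw [← sum_filter, sum_const, nsmul_eq_mul]
    rw [hite] at hZ
    -- (iii) the divisor-count parity
    obtain ⟨j, hj⟩ := card_filter_divisors_pure hsq hm0 (fun q => Odd (a q))
    have hcnt : (m.divisors.filter (fun d => 1 < d ∧ ∀ q ∈ d.primeFactors, Odd (a q))).card =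
        (m.properDivisors.filter (fun d => 1 < d ∧ ∀ q ∈ d.primeFactors, Odd (a q))).card +
          (if (1 < m ∧ ∀ q ∈ m.primeFactors, Odd (a q)) then 1 else 0) := by
      rw [← Nat.cons_self_properDivisors hm0, filter_cons]
      split_ifs with h
      · rw [card_cons]
      · simp
    -- (iv) the closed form of `F_m`
    have hA := minusHalfSum_closedForm_modTwo_away f hf hQ hu hq₀ hq₀o hq₀N hq₀M ha₀ ha₀o a m hsq hmo hmM hpr
    by_cases hall : ∀ q ∈ m.primeFactors, Odd (a q)
    · have hPm : (1 < m ∧ ∀ q ∈ m.primeFactors, Odd (a q)) := ⟨hm1', hall⟩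
      have hE : ∃ p ∈ m.primeFactors, Odd (a p) := by
        obtain ⟨p, hp⟩ := Nat.nonempty_primeFactors.2 hm1'
        exact ⟨p, hp, hall p hp⟩
      rw [if_pos hE] at hj
      rw [if_pos hPm, hj] at hcnt
      have hPD : ((m.properDivisors.filter (fun d => 1 < d ∧ ∀ q ∈ d.primeFactors, Odd (a q))).card : ℚ)
          = 2 * (j : ℚ) := by
        have : (m.properDivisors.filter (fun d => 1 < d ∧ ∀ q ∈ d.primeFactors, Odd (a q))).card = 2 * j := by
          omega
        exact_mod_cast this
      rw [hPD] at hZ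
      obtain ⟨z, hz⟩ := hA.1 hE
      refine ⟨fun _ => ⟨z - j * y - Z, ?_⟩, fun hn => absurd hPm hn⟩
      push_cast
      linear_combination (-1 : ℚ) * hsum + hz - hZ - 2 * (j : ℚ) * hy
    · have hPm : ¬ (1 < m ∧ ∀ q ∈ m.primeFactors, Odd (a q)) := fun h => hall h.2
      rw [if_neg hPm, add_zero] at hcnt
      refine ⟨fun h => absurd h hPm, fun _ => ?_⟩
      by_cases hE : ∃ p ∈ m.primeFactors, Odd (a p)
      · rw [if_pos hE, hcnt] at hj
        have hPD : ((m.properDivisors.filter (fun d => 1 < d ∧ ∀ q ∈ d.primeFactors, Odd (a q))).card : ℚ)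
            = 2 * (j : ℚ) + 1 := by exact_mod_cast hj
        rw [hPD] at hZ
        obtain ⟨z, hz⟩ := hA.1 hE
        refine ⟨z - j * y - Z, ?_⟩
        push_cast
        linear_combination (-1 : ℚ) * hsum + hz - hZ - 2 * (j : ℚ) * hy
      · rw [if_neg hE, hcnt, add_zero] at hj
        have hPD : ((m.properDivisors.filter (fun d => 1 < d ∧ ∀ q ∈ d.primeFactors, Odd (a q))).card : ℚ)
            = 2 * (j : ℚ) := by exact_mod_cast hj
        rw [hPD] at hZ
        have hev : ∀ q ∈ m.primeFactors, Even (a q) := by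
          intro q hq
          rcases Int.even_or_odd (a q) with h | h
          · exact h
          · exact absurd ⟨q, hq, h⟩ hE
        obtain ⟨z, hz⟩ := hA.2 hev
        refine ⟨z - j * y - Z, ?_⟩
        push_cast
        linear_combination (-1 : ℚ) * hsum + hz - hZ - 2 * (j : ℚ) * hy

end UnitsClosedForm

end Summit.BirchSwinnertonDyer.Rank1Residual.F1Sign2.ANg16
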